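import Literature.Barriers.CriticalPhenomena.PlaquetteWalkHoleRootNearCellsClassification
import Literature.Barriers.CriticalPhenomena.PlaquetteWalkHoleRootLawLClassification
import HarnessLib

/-!
# Barrier catalogue (SAWScalingLimit): LAW L — THE COMPLETE SINGLE-REMOVAL CLASSIFICATION around an interior hole

Leaf of `PlaquetteWalkHoleRootLawLClassification` (`lawL_box_kills_iff`: one cell at Chebyshev distance `≥ 2`) and
`PlaquetteWalkHoleRootNearCellsClassification` (`lawL_box_near_kills_iff`: the four near cells below / above the hole and the
root plaquette), with the far cell's two inner doors (`ΩG.doors_of_wound_far`, `PlaquetteWalkHoleRootFarCellLaw`). Setting: the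
`m × n` box with the hole `h` at distance `≥ 2` from every wall, the root plaquette `w = (h.1 + 1, h.2)` rooted at `W`, the far
cell `(h.1 − 1, h.2)`; ONE further cell `(x, y)` removed — ANY cell other than the hole, the far cell (where the functional lives)
and the root plaquette; `P₁ … P₄` the four universal kill statements of LAW L at the far cell.

★★★★★ `lawL_box_single_kills_iff` — at every angle `θ`, `P₁ ∨ P₂ ∨ P₃ ∨ P₄` **IFF** `(x, y)` is one of the far cell's three
doors `farWW, farSW, farNW = (h.1 − 2, h.2), (h.1 − 1, h.2 ∓ 1)` (no walk at the far cell is wound at all), **OR** a ring cell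
(distance exactly `2`) on the boundary of the box (the wall kills: corridor, shut row, pocket, east ray), **OR** a near cell
below / above (`x ∈ {h.1, h.1 + 1}`, `y = h.2 ∓ 1`) with the wall exactly two rows behind it (`h.2 = 2`, resp. `h.2 + 3 = n`),
**OR** a root notch (`x = h.1 + 1`, `y = h.2 ∓ 1`) with the root plaquette's eastern neighbour in the last column
(`h.1 + 3 = m`). Every other single removal leaves wound walks of all four kinds alive. Closed form `lawL_box_single_kills_iff'`.

Not in print; venture lane «pcv-sawmu», seat b-step0 gen 28 — the capstone of the lane's LAW L for single removals
(FINDING-LAWL-STATEMENT-OF-RECORD §A–§G).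

References: A. Glazman, I. Manolescu, arXiv:1708.00395v3, §1 (Fig. 1, Fig. 2, remark after eq. (1)), §2.1, §4.2, Lemma 2.1
[GlazmanManolescu2019]; A. Glazman, Electron. Commun. Probab. 20 (2015) no. 86, Lemma 3.1, proof pp. 6–7
[Glazman2015WeightedSAW]; R. Courant, H. Robbins, *What is Mathematics?* (1941/1958), Ch. V Appendix §2 (the even–odd
rule) [CourantRobbins1958].
-/

noncomputable section

open Set Function Complex

namespace Literature.Barriers.CriticalPhenomena.PlaquetteWalk

open Literature.Probability.RandomPlanarGeometry.SAW.YangBaxter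
open Real Complex

section SingleRemoval

variable {m n : ℕ} {h : Face}

/-- ★★★★★ **LAW L — THE COMPLETE SINGLE-REMOVAL CLASSIFICATION.** In the `m × n` box with the hole `h` at distance `≥ 2` from
every wall, remove the hole and ONE further cell `(x, y)` other than the hole, the far cell `(h.1 − 1, h.2)` and the root plaquette
`(h.1 + 1, h.2)`. Then, at every angle `θ`, SOME universal kill statement of LAW L holds at the far cell IF AND ONLY IF `(x, y)` is
a door of the far cell (`(h.1 − 2, h.2)`, `(h.1 − 1, h.2 − 1)`, `(h.1 − 1, h.2 + 1)`: no wound walk at all), or a ring cell on the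
boundary of the box, or a near cell below with `h.2 = 2`, or a near cell above with `h.2 + 3 = n`, or a root notch with
`h.1 + 3 = m`. [cite: GlazmanManolescu2019, §1 (Fig. 2 and the remark after eq. (1)), §2.1, §4.2, Lemma 2.1]
[cite: Glazman2015WeightedSAW, Lemma 3.1 (proof, pp. 6–7)] [cite: CourantRobbins1958, Ch. V Appendix §2 (the even–odd rule)] -/
theorem lawL_box_single_kills_iff (hW : 2 ≤ h.1) (hE : h.1 + 3 ≤ m) (hS : 2 ≤ h.2) (hN : h.2 + 3 ≤ n) {x y : ℤ}
    (hc : ((x, y) : Face) ≠ h) (hcf : ((x, y) : Face) ≠ (h.1 - 1, h.2)) (hcw : ((x, y) : Face) ≠ (h.1 + 1, h.2))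
    (hr : RootedFace (dom (boxMinus m n [h, (x, y)])) (Face.side (h.1 + 1, h.2) .W) (farW (h.1 + 1, h.2))) (θ : ℝ) :
    ((∀ (ω : ΩG (dom (boxMinus m n [h, (x, y)])) (Face.side (h.1 + 1, h.2) .W) (farW (h.1 + 1, h.2))) (hb : ω.IsB2a),
        ω.2.firstSideG = .S → ω.WE (fun _ => θ) ≠ excursionWinding θ ω.2.firstSideG (ω.z1 hr hb) ω.1 →
          ¬ω.2.W2FreeOff (farW (h.1 + 1, h.2))) ∨
      (∀ (ω : ΩG (dom (boxMinus m n [h, (x, y)])) (Face.side (h.1 + 1, h.2) .W) (farW (h.1 + 1, h.2))) (hb : ω.IsB2a),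
        ω.2.firstSideG = .N → ω.WE (fun _ => θ) ≠ excursionWinding θ ω.2.firstSideG (ω.z1 hr hb) ω.1 →
          ¬ω.2.W1FreeOff (farW (h.1 + 1, h.2))) ∨
      (∀ (ω : ΩG (dom (boxMinus m n [h, (x, y)])) (Face.side (h.1 + 1, h.2) .W) (farW (h.1 + 1, h.2))) (hb : ω.IsB2a),
        ω.2.firstSideG = .S → ω.WE (fun _ => θ) ≠ excursionWinding θ ω.2.firstSideG (ω.z1 hr hb) ω.1 →
          ¬ω.2.W1FreeOff (farW (h.1 + 1, h.2))) ∨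
      (∀ (ω : ΩG (dom (boxMinus m n [h, (x, y)])) (Face.side (h.1 + 1, h.2) .W) (farW (h.1 + 1, h.2))) (hb : ω.IsB2a),
        ω.2.firstSideG = .N → ω.WE (fun _ => θ) ≠ excursionWinding θ ω.2.firstSideG (ω.z1 hr hb) ω.1 →
          ¬ω.2.W2FreeOff (farW (h.1 + 1, h.2)))) ↔
      ((x = h.1 - 2 ∧ y = h.2) ∨ (x = h.1 - 1 ∧ (y = h.2 - 1 ∨ y = h.2 + 1)) ∨
        ((h.1 - 2 ≤ x ∧ x ≤ h.1 + 2 ∧ h.2 - 2 ≤ y ∧ y ≤ h.2 + 2 ∧ (x + 2 ≤ h.1 ∨ h.1 + 2 ≤ x ∨ y + 2 ≤ h.2 ∨ h.2 + 2 ≤ y)) ∧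
          (x = 0 ∨ x + 1 = m ∨ y = 0 ∨ y + 1 = n)) ∨
        ((x = h.1 ∨ x = h.1 + 1) ∧ ((y = h.2 - 1 ∧ h.2 = 2) ∨ (y = h.2 + 1 ∧ h.2 + 3 = n))) ∨
        (x = h.1 + 1 ∧ (y = h.2 - 1 ∨ y = h.2 + 1) ∧ h.1 + 3 = m)) := by
  by_cases hfar : x + 2 ≤ h.1 ∨ h.1 + 2 ≤ x ∨ y + 2 ≤ h.2 ∨ h.2 + 2 ≤ y
  · -- Chebyshev distance ≥ 2: `lawL_box_kills_iff`
    rw [lawL_box_kills_iff hW hE hS hN hfar hr θ]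
    constructor
    · rintro (hw | ⟨hring, hb⟩)
      · exact Or.inl hw
      · exact Or.inr (Or.inr (Or.inl ⟨⟨hring.1, hring.2.1, hring.2.2.1, hring.2.2.2, hfar⟩, hb⟩))
    · rintro (hw | ⟨hx, hy⟩ | ⟨⟨⟨h1, h2, h3, h4, -⟩, hb⟩⟩ | ⟨hx, hy⟩ | ⟨hx, hy, -⟩)
      · exact Or.inl hw
      · exfalso; omega
      · exact Or.inr ⟨⟨h1, h2, h3, h4⟩, hb⟩
      · exfalso; omega
      · exfalso; omega
  · -- Chebyshev distance 1: the two inner doors, or one of the four near cells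
    have hx1 : h.1 - 1 ≤ x ∧ x ≤ h.1 + 1 := by omega
    have hy1 : h.2 - 1 ≤ y ∧ y ≤ h.2 + 1 := by omega
    by_cases hdoor : x = h.1 - 1
    · -- `farSW` / `farNW`: no wound walk at all, every kill statement holds vacuously
      have hy' : y = h.2 - 1 ∨ y = h.2 + 1 := by
        rcases lt_trichotomy y h.2 with hl | he | hg
        · left; omega
        · exact absurd (Prod.ext hdoor he) hcf
        · right; omega
      have hhD : holeFaceW ((h.1 + 1, h.2) : Face) ∉ dom (boxMinus m n [h, (x, y)]) := by
        rw [holeFaceW_hroot]; exact not_mem_dom_boxMinus_of_mem (by simp)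
      have hunw : ∀ (ω : ΩG (dom (boxMinus m n [h, (x, y)])) (Face.side (h.1 + 1, h.2) .W) (farW (h.1 + 1, h.2)))
          (hb : ω.IsB2a), ω.WE (fun _ => θ) = excursionWinding θ ω.2.firstSideG (ω.z1 hr hb) ω.1 := by
        intro ω hb
        by_contra hWd
        obtain ⟨hNW, hSW, -⟩ := ΩG.doors_of_wound_far hhD ω hr hb hWd
        rcases hy' with rfl | rfl
        · have e : farSW ((h.1 + 1, h.2) : Face) = (x, h.2 - 1) := Prod.ext (by simp only [farSW]; omega) rfl
          rw [e] at hSW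
          exact not_mem_dom_boxMinus_of_mem (by simp) hSW
        · have e : farNW ((h.1 + 1, h.2) : Face) = (x, h.2 + 1) := Prod.ext (by simp only [farNW]; omega) rfl
          rw [e] at hNW
          exact not_mem_dom_boxMinus_of_mem (by simp) hNW
      constructor
      · intro _; exact Or.inr (Or.inl ⟨hdoor, hy'⟩)
      · intro _; exact Or.inl fun ω hb _ hWd => absurd (hunw ω hb) hWd
    · -- a near cell: `lawL_box_near_kills_iff`
      have hnear : (x = h.1 ∨ x = h.1 + 1) ∧ (y = h.2 - 1 ∨ y = h.2 + 1) := by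
        refine ⟨by omega, ?_⟩
        rcases lt_trichotomy y h.2 with hl | he | hg
        · left; omega
        · exfalso
          rcases (show x = h.1 ∨ x = h.1 + 1 by omega) with hx | hx
          · exact hc (Prod.ext hx he)
          · exact hcw (Prod.ext hx he)
        · right; omega
      rw [lawL_box_near_kills_iff hW hE hS hN hnear hr θ]
      constructor
      · rintro (⟨hy, h2⟩ | ⟨hy, h3⟩ | ⟨hx, h3⟩)
        · exact Or.inr (Or.inr (Or.inr (Or.inl ⟨hnear.1, Or.inl ⟨hy, h2⟩⟩)))
        · exact Or.inr (Or.inr (Or.inr (Or.inl ⟨hnear.1, Or.inr ⟨hy, h3⟩⟩)))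
        · exact Or.inr (Or.inr (Or.inr (Or.inr ⟨hx, hnear.2, h3⟩)))
      · rintro (hw | ⟨hx, -⟩ | ⟨⟨⟨-, -, -, -, hf⟩, -⟩⟩ | ⟨-, hk⟩ | ⟨hx, -, h3⟩)
        · exfalso; omega
        · exact absurd hx hdoor
        · exact absurd hf hfar
        · rcases hk with ⟨hy, h2⟩ | ⟨hy, h3⟩
          · exact Or.inl ⟨hy, h2⟩
          · exact Or.inr (Or.inl ⟨hy, h3⟩)
        · exact Or.inr (Or.inr ⟨hx, h3⟩)

/-- The far cell is kept and the hole root is rooted for any single removal other than the far cell (hole `≥ 2` from the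
walls). [cite: GlazmanManolescu2019, §2.1 (walks start on the boundary of the domain)] -/
theorem rootedFace_hroot_boxMinus_single (hW : 2 ≤ h.1) (hE : h.1 + 3 ≤ m) (hS : 2 ≤ h.2) (hN : h.2 + 3 ≤ n) {x y : ℤ}
    (hcf : ((x, y) : Face) ≠ (h.1 - 1, h.2)) :
    RootedFace (dom (boxMinus m n [h, (x, y)])) (Face.side (h.1 + 1, h.2) .W) (farW (h.1 + 1, h.2)) :=
  rootedFace_hroot_boxMinus_cell hW hE hS hN fun hq => hcf (Prod.ext hq.1 hq.2)

/-- ★★★★★ **LAW L — THE COMPLETE SINGLE-REMOVAL CLASSIFICATION, closed form** (the rooting hypothesis discharged).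
[cite: GlazmanManolescu2019, §1 (Fig. 2 and the remark after eq. (1)), §2.1, §4.2, Lemma 2.1]
[cite: Glazman2015WeightedSAW, Lemma 3.1 (proof, pp. 6–7)] [cite: CourantRobbins1958, Ch. V Appendix §2 (the even–odd rule)] -/
theorem lawL_box_single_kills_iff' (hW : 2 ≤ h.1) (hE : h.1 + 3 ≤ m) (hS : 2 ≤ h.2) (hN : h.2 + 3 ≤ n) {x y : ℤ}
    (hc : ((x, y) : Face) ≠ h) (hcf : ((x, y) : Face) ≠ (h.1 - 1, h.2)) (hcw : ((x, y) : Face) ≠ (h.1 + 1, h.2)) (θ : ℝ) :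
    let hr := rootedFace_hroot_boxMinus_single hW hE hS hN hcf
    ((∀ (ω : ΩG (dom (boxMinus m n [h, (x, y)])) (Face.side (h.1 + 1, h.2) .W) (farW (h.1 + 1, h.2))) (hb : ω.IsB2a),
        ω.2.firstSideG = .S → ω.WE (fun _ => θ) ≠ excursionWinding θ ω.2.firstSideG (ω.z1 hr hb) ω.1 →
          ¬ω.2.W2FreeOff (farW (h.1 + 1, h.2))) ∨
      (∀ (ω : ΩG (dom (boxMinus m n [h, (x, y)])) (Face.side (h.1 + 1, h.2) .W) (farW (h.1 + 1, h.2))) (hb : ω.IsB2a),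
        ω.2.firstSideG = .N → ω.WE (fun _ => θ) ≠ excursionWinding θ ω.2.firstSideG (ω.z1 hr hb) ω.1 →
          ¬ω.2.W1FreeOff (farW (h.1 + 1, h.2))) ∨
      (∀ (ω : ΩG (dom (boxMinus m n [h, (x, y)])) (Face.side (h.1 + 1, h.2) .W) (farW (h.1 + 1, h.2))) (hb : ω.IsB2a),
        ω.2.firstSideG = .S → ω.WE (fun _ => θ) ≠ excursionWinding θ ω.2.firstSideG (ω.z1 hr hb) ω.1 →
          ¬ω.2.W1FreeOff (farW (h.1 + 1, h.2))) ∨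
      (∀ (ω : ΩG (dom (boxMinus m n [h, (x, y)])) (Face.side (h.1 + 1, h.2) .W) (farW (h.1 + 1, h.2))) (hb : ω.IsB2a),
        ω.2.firstSideG = .N → ω.WE (fun _ => θ) ≠ excursionWinding θ ω.2.firstSideG (ω.z1 hr hb) ω.1 →
          ¬ω.2.W2FreeOff (farW (h.1 + 1, h.2)))) ↔
      ((x = h.1 - 2 ∧ y = h.2) ∨ (x = h.1 - 1 ∧ (y = h.2 - 1 ∨ y = h.2 + 1)) ∨
        ((h.1 - 2 ≤ x ∧ x ≤ h.1 + 2 ∧ h.2 - 2 ≤ y ∧ y ≤ h.2 + 2 ∧ (x + 2 ≤ h.1 ∨ h.1 + 2 ≤ x ∨ y + 2 ≤ h.2 ∨ h.2 + 2 ≤ y)) ∧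
          (x = 0 ∨ x + 1 = m ∨ y = 0 ∨ y + 1 = n)) ∨
        ((x = h.1 ∨ x = h.1 + 1) ∧ ((y = h.2 - 1 ∧ h.2 = 2) ∨ (y = h.2 + 1 ∧ h.2 + 3 = n))) ∨
        (x = h.1 + 1 ∧ (y = h.2 - 1 ∨ y = h.2 + 1) ∧ h.1 + 3 = m)) :=
  lawL_box_single_kills_iff hW hE hS hN hc hcf hcw _ θ

end SingleRemoval

end Literature.Barriers.CriticalPhenomena.PlaquetteWalk
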